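import Mathlib.Analysis.Convex.SimplicialComplex.Basic
import Mathlib.Analysis.InnerProductSpace.PiL2
import Mathlib.LinearAlgebra.Matrix.Determinant.Basic
import Mathlib.LinearAlgebra.AffineSpace.AffineMap
import Mathlib.LinearAlgebra.Matrix.Notation
import HarnessLib

/-!
# Positive integral tropical fan data on a triangulated 4-manifold (the discrete fan picture of Gross–Siebert)

Topic `Literature/AlgebraicGeometry/TropicalManifolds`; definition item
`defn-IsPositiveTropicalFanData` (route `SmoothPoincare4/TropicalFanoSkeleton`, "D-trop": the helper
definitions `coneAt` and `IsPositiveTropicalFanData K v₀ x` of the planner's sketch, inlined VERBATIM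
as the datum clause of the items `TropicalCollapse`, `TropicalBall`, `SimplexTropicalCalibration` —
this file names that clause so those items read `IsPositiveTropicalFanData K v₀ x`, see the `example`
below the definition, which is `Iff.rfl` against the literal route text).

The datum. `K` is a (geometric) simplicial complex in `ℝ^N` (Mathlib
`Geometry.SimplicialComplex`), in the application a smooth triangulation of a closed 4-manifold;
`v₀` a vertex ("at infinity"); `x a w ∈ ℝ⁴` the position of the vertex `w` in the chart at the
vertex `a`. The predicate asks: (i) INTEGRALITY — all `x a w ∈ ℤ⁴`, `x a a = 0`; (ii) at every vertex
`a ≠ v₀` a complete, unimodular, projective SIMPLICIAL FAN — the generators `x a w`, `w ∈ σ ∖ a`, of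
every `4`-simplex `σ ∋ a` have `|det| = 1`, the cones `cone_a(τ) = {Σ_{w ∈ τ ∖ a} c_w x a w, c ≥ 0}`
(`coneAt x a τ`) of the faces through `a` meet along cones of common faces, cover `ℝ⁴`, and admit a
strictly convex conewise-linear support function (functionals `m_σ` with `⟨m_σ', y⟩ ≤ ⟨m_σ, y⟩` on
`cone_a(σ)`, equality only on `cone_a(σ')`) — this is the "fan structure at a vertex" of a tropical
(integral affine) manifold in the fan picture, `v₀` entering only as a ray direction
[GrossSiebert2011, §1.1]; (iii) POSITIVE SHEAR MONODROMY — for every codimension-one face `ρ`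
(`card ρ = 4`) with distinct cofaces `σp`, `σm` and vertices `a ≠ b` of `ρ` (both `≠ v₀`), any two
affine chart changes `ψp`, `ψm : ℝ⁴ → ℝ⁴` from chart `a` to chart `b` matching the vertex data of `σp`
resp. `σm` differ by the shear `y ↦ y + κ · det[y, g] · det[x a wp, g] · (x a b)` with `κ ≥ 0`
(`g` the three other vertices of `ρ`, `wp = σp ∖ ρ`; `det[·, g]` is an integral conormal of `ρ`,
normalised to be positive on `σp` by the second determinant) — Gross–Siebert's monodromy
"`T_ωρ(m) = m + κ_ωρ ⟨m, ď_ρ⟩ d_ω`" around the codimension-two discriminant and the POSITIVITY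
`κ_ωρ ≥ 0` of [GrossSiebert2011, Def. 1.4 with §1.1 (1.1)].

## Design notes

* Verbatim the planner's typing (so that the route items are definitionally
  `IsPositiveTropicalFanData K v₀ x`); in particular vertices are points of `ℝ^N`, faces are
  `Finset`s in `K.faces`, top simplices have `card = 5` (dimension `4` is hard-wired, as in the route),
  coefficients `c : ℝ^N → ℝ` are total functions (only their values on `τ.erase a` matter).
* `coneAt x a τ` is the closed convex cone spanned by `{x a w : w ∈ τ, w ≠ a}`; `0 ∈ coneAt`
  (`zero_mem_coneAt`), monotone in `τ` (`coneAt_mono`).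
* Not here (later requests of the route): Gross–Siebert simplicity (logmirror I, Def. 1.60) and
  multivalued pre-polarisations as further predicates on the same data; the reconstruction theorem
  [GrossSiebert2011, Thm. 1.29] as a named fact.

## References

* [GrossSiebert2011] M. Gross, B. Siebert, *From real affine geometry to complex geometry*, Ann. of
  Math. 174 (2011) = arXiv:math/0703822, §1.1 (tropical manifolds, fan structures at vertices,
  monodromy `T_ωρ`, (1.1)), Def. 1.4 (positivity `κ_ωρ ≥ 0`), Ex. 1.11.
-/

noncomputable section

open scoped BigOperators

namespace Literature.AlgebraicGeometry.TropicalManifolds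

variable {N : ℕ}

/-- **The cone at `a` of the face `τ` in the chart `x a`**: `cone_a(τ) = {Σ_{w ∈ τ ∖ a} c_w · x a w :
c ≥ 0} ⊆ ℝ⁴`, the closed convex cone spanned by the chart positions of the other vertices of `τ`
(coefficients indexed by all of `ℝ^N`, only the values on `τ.erase a` matter). The cones of the faces
through `a` form the fan structure at the vertex `a` of the tropical manifold.
[cite: GrossSiebert2011, §1.1 (fan structure at a vertex)] -/
def coneAt (x : EuclideanSpace ℝ (Fin N) → EuclideanSpace ℝ (Fin N) → (Fin 4 → ℝ))
    (a : EuclideanSpace ℝ (Fin N)) (τ : Finset (EuclideanSpace ℝ (Fin N))) : Set (Fin 4 → ℝ) :=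
  {y : Fin 4 → ℝ | ∃ c : EuclideanSpace ℝ (Fin N) → ℝ, (∀ w, 0 ≤ c w) ∧ y = ∑ w ∈ (τ).erase a, c w • x a w}

/-- **Positive integral tropical fan data** `x` on the triangulation `K` with vertex at infinity
`v₀`: integrality and `x a a = 0`; at every vertex `a ≠ v₀` a complete unimodular projective
simplicial fan formed by the cones `coneAt x a τ` of the faces `τ ∋ a` (unimodularity of the
generators of every `4`-simplex, fan intersection axiom, completeness, a strictly convex
conewise-linear support function); and POSITIVE SHEAR MONODROMY across every codimension-one face
`ρ` with distinct cofaces `σp ≠ σm`: chart changes `a → b` through `σp` and through `σm` differ by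
`y ↦ y + κ · det[y, g] · det[x a wp, g] · x a b` with `κ ≥ 0` — Gross–Siebert's
`T_ωρ(m) = m + κ_ωρ⟨m, ď_ρ⟩ d_ω` with `κ_ωρ ≥ 0` (positivity). Verbatim the datum clause of the route
`SmoothPoincare4/TropicalFanoSkeleton` (items `TropicalCollapse`, `TropicalBall`,
`SimplexTropicalCalibration`). [cite: GrossSiebert2011, §1.1 (1.1) and Def. 1.4 (positive tropical manifolds)] -/
def IsPositiveTropicalFanData (K : Geometry.SimplicialComplex ℝ (EuclideanSpace ℝ (Fin N)))
    (v₀ : EuclideanSpace ℝ (Fin N))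
    (x : EuclideanSpace ℝ (Fin N) → EuclideanSpace ℝ (Fin N) → (Fin 4 → ℝ)) : Prop :=
  (∀ a w i, ∃ z : ℤ, x a w i = z) ∧ (∀ a, x a a = 0) ∧ (∀ a : EuclideanSpace ℝ (Fin N), ({a} : Finset (EuclideanSpace ℝ (Fin N))) ∈ K.faces → a ≠ v₀ → (∀ σ ∈ K.faces, a ∈ σ → σ.card = 5 → ∀ f : Fin 4 → EuclideanSpace ℝ (Fin N), Function.Injective f → (∀ i, f i ∈ σ.erase a) → |Matrix.det (Matrix.of fun i j => x a (f i) j)| = 1) ∧ (∀ τ ∈ K.faces, ∀ τ' ∈ K.faces, a ∈ τ → a ∈ τ' → coneAt x a (τ) ∩ coneAt x a (τ') = coneAt x a (τ ∩ τ')) ∧ (⋃ τ ∈ {τ ∈ K.faces | a ∈ τ}, coneAt x a (τ)) = Set.univ ∧ (∃ m : Finset (EuclideanSpace ℝ (Fin N)) → (Fin 4 → ℝ), ∀ σ ∈ K.faces, ∀ σ' ∈ K.faces, a ∈ σ → a ∈ σ' → σ.card = 5 → σ'.card = 5 → ∀ y ∈ coneAt x a (σ), (∑ i, m σ' i * y i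 ≤ ∑ i, m σ i * y i) ∧ ((∑ i, m σ' i * y i = ∑ i, m σ i * y i) → y ∈ coneAt x a (σ')))) ∧ (∀ ρ ∈ K.faces, ρ.card = 4 → ∀ σp ∈ K.faces, ∀ σm ∈ K.faces, σp.card = 5 → σm.card = 5 → ρ ⊆ σp → ρ ⊆ σm → σp ≠ σm → ∀ a ∈ ρ, ∀ b ∈ ρ, a ≠ b → a ≠ v₀ → b ≠ v₀ → ∀ ψp ψm : (Fin 4 → ℝ) →ᵃ[ℝ] (Fin 4 → ℝ), (∀ w ∈ σp, w ≠ v₀ → ψp (x a w) = x b w) → (v₀ ∈ σp → ψp.linear (x a v₀) = x b v₀) → (∀ w ∈ σm, w ≠ v₀ → ψm (x a w) = x b w) → (v₀ ∈ σm → ψm.linear (x a v₀) = x b v₀) → ∀ wp ∈ σp, wp ∉ ρ → ∀ g : Fin 3 → EuclideanSpace ℝ (Fin N), Function.Injective g → (∀ i, g i ∈ ρ.erase a) → ∃ κ : ℝ, 0 ≤ κ ∧ ∀ y : Fin 4 → ℝ, ψp y = ψm (y + (κ * Matrix.det (Matrix.of ![y, x a (g 0), x a (g 1), x a (g 2)])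 * Matrix.det (Matrix.of ![x a wp, x a (g 0), x a (g 1), x a (g 2)])) • x a b))

/- The datum clause inlined by the route `Summits/SmoothPoincare4/SmoothPoincare4/Theses/
TropicalFanoSkeleton.lean` (items `TropicalCollapse`, `TropicalBall`, `SimplexTropicalCalibration`)
is *literally* `IsPositiveTropicalFanData K v₀ x`: -/
example (K : Geometry.SimplicialComplex ℝ (EuclideanSpace ℝ (Fin N))) (v₀ : EuclideanSpace ℝ (Fin N))
    (x : EuclideanSpace ℝ (Fin N) → EuclideanSpace ℝ (Fin N) → (Fin 4 → ℝ)) :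
    ((∀ a w i, ∃ z : ℤ, x a w i = z) ∧ (∀ a, x a a = 0) ∧ (∀ a : EuclideanSpace ℝ (Fin N), ({a} : Finset (EuclideanSpace ℝ (Fin N))) ∈ K.faces → a ≠ v₀ → (∀ σ ∈ K.faces, a ∈ σ → σ.card = 5 → ∀ f : Fin 4 → EuclideanSpace ℝ (Fin N), Function.Injective f → (∀ i, f i ∈ σ.erase a) → |Matrix.det (Matrix.of fun i j => x a (f i) j)| = 1) ∧ (∀ τ ∈ K.faces, ∀ τ' ∈ K.faces, a ∈ τ → a ∈ τ' → {y : Fin 4 → ℝ | ∃ c : EuclideanSpace ℝ (Fin N) → ℝ, (∀ w, 0 ≤ c w) ∧ y = ∑ w ∈ (τ).erase a, c w • x a w} ∩ {y : Fin 4 → ℝ | ∃ c : EuclideanSpace ℝ (Fin N) → ℝ, (∀ w, 0 ≤ c w) ∧ y = ∑ w ∈ (τ').erase a, c w • x a w} = {y : Fin 4 → ℝ | ∃ c : EuclideanSpace ℝ (Fin N) → ℝ, (∀ w, 0 ≤ c w) ∧ y = ∑ w ∈ (τ ∩ τ').erase a, c w • x a w}) ∧ (⋃ τ ∈ {τ ∈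 K.faces | a ∈ τ}, {y : Fin 4 → ℝ | ∃ c : EuclideanSpace ℝ (Fin N) → ℝ, (∀ w, 0 ≤ c w) ∧ y = ∑ w ∈ (τ).erase a, c w • x a w}) = Set.univ ∧ (∃ m : Finset (EuclideanSpace ℝ (Fin N)) → (Fin 4 → ℝ), ∀ σ ∈ K.faces, ∀ σ' ∈ K.faces, a ∈ σ → a ∈ σ' → σ.card = 5 → σ'.card = 5 → ∀ y ∈ {y : Fin 4 → ℝ | ∃ c : EuclideanSpace ℝ (Fin N) → ℝ, (∀ w, 0 ≤ c w) ∧ y = ∑ w ∈ (σ).erase a, c w • x a w}, (∑ i, m σ' i * y i ≤ ∑ i, m σ i * y i) ∧ ((∑ i, m σ' i * y i = ∑ i, m σ i * y i) → y ∈ {y : Fin 4 → ℝ | ∃ c : EuclideanSpace ℝ (Fin N) → ℝ, (∀ w, 0 ≤ c w) ∧ y = ∑ w ∈ (σ').erase a, c w • x a w}))) ∧ (∀ ρ ∈ K.faces, ρ.card = 4 → ∀ σp ∈ K.faces, ∀ σm ∈ K.faces, σp.card = 5 → σm.card = 5 → ρ ⊆ σp → ρ ⊆ σm → σp ≠ σm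 → ∀ a ∈ ρ, ∀ b ∈ ρ, a ≠ b → a ≠ v₀ → b ≠ v₀ → ∀ ψp ψm : (Fin 4 → ℝ) →ᵃ[ℝ] (Fin 4 → ℝ), (∀ w ∈ σp, w ≠ v₀ → ψp (x a w) = x b w) → (v₀ ∈ σp → ψp.linear (x a v₀) = x b v₀) → (∀ w ∈ σm, w ≠ v₀ → ψm (x a w) = x b w) → (v₀ ∈ σm → ψm.linear (x a v₀) = x b v₀) → ∀ wp ∈ σp, wp ∉ ρ → ∀ g : Fin 3 → EuclideanSpace ℝ (Fin N), Function.Injective g → (∀ i, g i ∈ ρ.erase a) → ∃ κ : ℝ, 0 ≤ κ ∧ ∀ y : Fin 4 → ℝ, ψp y = ψm (y + (κ * Matrix.det (Matrix.of ![y, x a (g 0), x a (g 1), x a (g 2)]) * Matrix.det (Matrix.of ![x a wp, x a (g 0), x a (g 1), x a (g 2)])) • x a b))) ↔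
      IsPositiveTropicalFanData K v₀ x :=
  Iff.rfl

/-! ### API -/

section API

variable (x : EuclideanSpace ℝ (Fin N) → EuclideanSpace ℝ (Fin N) → (Fin 4 → ℝ))
  (a : EuclideanSpace ℝ (Fin N))

/-- Membership in a cone (definitional). [cite: GrossSiebert2011, §1.1] -/
theorem mem_coneAt_iff {τ : Finset (EuclideanSpace ℝ (Fin N))} {y : Fin 4 → ℝ} :
    y ∈ coneAt x a τ ↔ ∃ c : EuclideanSpace ℝ (Fin N) → ℝ, (∀ w, 0 ≤ c w) ∧
      y = ∑ w ∈ τ.erase a, c w • x a w :=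
  Iff.rfl

/-- The apex: `0 ∈ cone_a(τ)`. [folklore] -/
theorem zero_mem_coneAt (τ : Finset (EuclideanSpace ℝ (Fin N))) : (0 : Fin 4 → ℝ) ∈ coneAt x a τ :=
  ⟨0, fun _ => le_rfl, by simp⟩

/-- The generators: `x a w ∈ cone_a(τ)` for `w ∈ τ`, `w ≠ a`. [folklore] -/
theorem apply_mem_coneAt {τ : Finset (EuclideanSpace ℝ (Fin N))} {w : EuclideanSpace ℝ (Fin N)}
    (hw : w ∈ τ) (hwa : w ≠ a) : x a w ∈ coneAt x a τ := by
  classical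
  refine ⟨fun u => if u = w then 1 else 0, fun u => by dsimp only; split_ifs <;> norm_num, ?_⟩
  rw [Finset.sum_eq_single w]
  · simp
  · intro u _ huw; simp [huw]
  · intro h; exact absurd (Finset.mem_erase.2 ⟨hwa, hw⟩) h

/-- Cones are closed under addition. [folklore] -/
theorem add_mem_coneAt {τ : Finset (EuclideanSpace ℝ (Fin N))} {y z : Fin 4 → ℝ}
    (hy : y ∈ coneAt x a τ) (hz : z ∈ coneAt x a τ) : y + z ∈ coneAt x a τ := by
  obtain ⟨c, hc, rfl⟩ := hy
  obtain ⟨d, hd, rfl⟩ := hz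
  refine ⟨fun w => c w + d w, fun w => add_nonneg (hc w) (hd w), ?_⟩
  rw [← Finset.sum_add_distrib]
  exact Finset.sum_congr rfl fun w _ => by rw [add_smul]

/-- Cones are closed under nonnegative scaling. [folklore] -/
theorem smul_mem_coneAt {τ : Finset (EuclideanSpace ℝ (Fin N))} {y : Fin 4 → ℝ} {t : ℝ} (ht : 0 ≤ t)
    (hy : y ∈ coneAt x a τ) : t • y ∈ coneAt x a τ := by
  obtain ⟨c, hc, rfl⟩ := hy
  refine ⟨fun w => t * c w, fun w => mul_nonneg ht (hc w), ?_⟩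
  rw [Finset.smul_sum]
  exact Finset.sum_congr rfl fun w _ => by rw [mul_smul]

/-- `cone_a` is monotone in the face. [folklore] -/
theorem coneAt_mono {τ τ' : Finset (EuclideanSpace ℝ (Fin N))} (h : τ ⊆ τ') : coneAt x a τ ⊆ coneAt x a τ' := by
  classical
  rintro y ⟨c, hc, rfl⟩
  refine ⟨fun w => if w ∈ τ then c w else 0, fun w => by dsimp only; split_ifs; exacts [hc w, le_rfl], ?_⟩
  rw [← Finset.sum_subset (Finset.erase_subset_erase a h)]
  · exact Finset.sum_congr rfl fun w hw => by dsimp only; rw [if_pos (Finset.mem_of_mem_erase hw)]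
  · intro w _ hw
    have : w ∉ τ := fun hwτ => hw (Finset.mem_erase.2 ⟨(Finset.mem_erase.1 ‹w ∈ τ'.erase a›).1, hwτ⟩)
    simp [this]

variable {x a}

/-- Integrality projection. [cite: GrossSiebert2011, §1.1 (integral affine structure)] -/
theorem IsPositiveTropicalFanData.integral {K : Geometry.SimplicialComplex ℝ (EuclideanSpace ℝ (Fin N))}
    {v₀ : EuclideanSpace ℝ (Fin N)} (h : IsPositiveTropicalFanData K v₀ x)
    (a w : EuclideanSpace ℝ (Fin N)) (i : Fin 4) : ∃ z : ℤ, x a w i = z :=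
  h.1 a w i

/-- The chart at `a` is centred at `a`: `x a a = 0`. [cite: GrossSiebert2011, §1.1] -/
theorem IsPositiveTropicalFanData.apply_self {K : Geometry.SimplicialComplex ℝ (EuclideanSpace ℝ (Fin N))}
    {v₀ : EuclideanSpace ℝ (Fin N)} (h : IsPositiveTropicalFanData K v₀ x)
    (a : EuclideanSpace ℝ (Fin N)) : x a a = 0 :=
  h.2.1 a

end API

end Literature.AlgebraicGeometry.TropicalManifolds

end
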